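import Summits.AtomisticToContinuum.Crystallization.Theorems.ThreeConeCertificateSlackRigidityRootingSlack
import Summits.AtomisticToContinuum.Crystallization.Theorems.ThreeConeCertificateSlackRigidityRootingCount

/-!
# Line `c-layer-witness-strictness` for crux `SlackRigidity` (stmt-AtomisticToContinuum-11960):
# rooting, part 3 — the registered stub `stub_rooting`

From a failing witness `P` (`¬ RigidFor P`) and certificate data (split `V_LJ = g + U + f` on
`(0,∞)` with `U ≥ 0`, `f` of positive type, star functional `F ≥ 0` certifying `c(g)`, exact
constant `c + f(0)/2 = −e(P)`, trial-state bound), produce a ROOTED small-slack bad sequence: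
`1/3`-separated sets `S_k ∋ 0` (recentred thinned near-minimisers), none root-matched at `(R, ε)`,
whose local `(F, U)`-slack vanishes.  Proof (lead's plan, NOTES.md §Vetting/rooting):
(0) `¬ RigidFor P` gives `(R, ε)`, an injective `o(N)`-excess sequence `x` and `θ > 0` with
`#bad ≥ θN` frequently; (1) total slack `Σ_i F(star_i) + Σ_{i<j} U ≤ 𝓔(z) − M e(P)`
(`sum_star_add_interactionEnergy_le`); (2) thinning (`stub_thinning`, a hypothesis here) costs
`o(N)` particles, so the slack of the thinned `y_N` is `≤ excess(1 + |e(P)|/K) + ηN` eventually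
(trial bound), i.e. `o(N)`; (3) `#bad(x_N) ≤ #bad(y_N) + o(N)` (`badCount_le_badCount_thinned`);
(4) double counting + Markov (`sum_sum_filter_le_mul_sum`, `card_filter_mul_le_sum`): frequently
some bad particle of `y_N` has `L`-local slack `≤ η`; (5) diagonal `L = k`, `η = 1/(k+1)` and the
dictionary `Good ↔ root-matched` (`good_iff_rootMatched_image`). [folklore]
-/

noncomputable section

namespace Summit.AtomisticToContinuum.Crystallization.Theorems.CLayerWitnessRooting

open scoped BigOperators Topology
open Filter
open Literature.MathematicalPhysics.StatisticalMechanics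
open Summit.AtomisticToContinuum.Crystallization.Theorems.SlackRigidityNegative
  (E3 Good RigidFor ExcessVanishes BadFractionVanishes badCount)

/-! ## Small lemmas -/

/-- A nonnegative real sequence that does not tend to `0` is frequently above some `θ > 0`.
[folklore] -/
theorem exists_frequently_le_of_not_tendsto {u : ℕ → ℝ} (hu : ∀ N, 0 ≤ u N)
    (h : ¬ Tendsto u atTop (𝓝 0)) : ∃ θ : ℝ, 0 < θ ∧ ∃ᶠ N in atTop, θ ≤ u N := by
  by_contra hcon
  push Not at hcon
  apply h
  rw [tendsto_order]
  exact ⟨fun a ha => Eventually.of_forall fun N => ha.trans_le (hu N), fun a ha => hcon a ha⟩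

/-- Recentring twice: `(· − (z j − z i)) '' ((· − z i) '' range z) = (· − z j) '' range z`. [folklore] -/
theorem image_sub_image_sub {M : ℕ} (z : Fin M → E3) (i j : Fin M) :
    (fun w => w - (z j - z i)) '' ((fun w => w - z i) '' Set.range z) =
      (fun w => w - z j) '' Set.range z := by
  rw [Set.image_image]
  congr 1
  funext w
  abel

/-- In the recentred set, `dist (z j − z i) (z j' − z i) = dist (z j) (z j')`. [folklore] -/
theorem dist_sub_sub_eq {M : ℕ} (z : Fin M → E3) (i j j' : Fin M) :
    dist (z j - z i) (z j' - z i) = dist (z j) (z j') := by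
  rw [dist_eq_norm, dist_eq_norm, sub_sub_sub_cancel_right]

/-- Translates of a `δ`-separated range are `δ`-separated. [folklore] -/
theorem separated_image_sub_range {M : ℕ} {z : Fin M → E3} {δ : ℝ}
    (hsep : ∀ i j : Fin M, i ≠ j → δ ≤ dist (z i) (z j)) (v : E3) :
    ∀ p ∈ (fun w => w - v) '' Set.range z, ∀ q ∈ (fun w => w - v) '' Set.range z,
      p ≠ q → δ ≤ dist p q := by
  rintro p ⟨_, ⟨i, rfl⟩, rfl⟩ q ⟨_, ⟨j, rfl⟩, rfl⟩ hpq
  have hij : i ≠ j := fun h => hpq (by rw [h])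
  have := hsep i j hij
  rwa [dist_sub_right]

/-! ## One configuration: local slack, double counting, a bad particle of small local slack -/

section OneConfig

variable {ρ' : ℝ} {U : ℝ → ℝ} {F : Set E3 → ℝ} {M : ℕ} {z : Fin M → E3}

/-- The site weight `τ_j = F(star_j) + Σ_{k ≠ j} U(r_jk)` is nonnegative. [folklore] -/
theorem siteWeight_nonneg (hU0 : ∀ r : ℝ, 0 < r → 0 ≤ U r) (hF0 : ∀ T : Set E3, 0 ≤ F T)
    (hz : Function.Injective z) (j : Fin M) :
    0 ≤ F (((fun w => w - z j) '' Set.range z) ∩ Metric.closedBall 0 ρ') +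
      siteEnergy U z j := by
  refine add_nonneg (hF0 _) (Finset.sum_nonneg fun k hk => hU0 _ ?_)
  exact dist_pos.2 (hz.ne (Finset.ne_of_mem_erase hk).symm)

/-- Sum of the site weights: `Σ_j τ_j = Σ_j F(star_j) + 2 Σ_{j<k} U ≤ 2·slack`. [folklore] -/
theorem sum_siteWeight_le (hF0 : ∀ T : Set E3, 0 ≤ F T) :
    ∑ j, (F (((fun w => w - z j) '' Set.range z) ∩ Metric.closedBall 0 ρ') + siteEnergy U z j) ≤
      2 * (∑ j, F (((fun w => w - z j) '' Set.range z) ∩ Metric.closedBall 0 ρ') +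
        interactionEnergy U z) := by
  rw [Finset.sum_add_distrib, ← two_mul_interactionEnergy]
  have : 0 ≤ ∑ j, F (((fun w => w - z j) '' Set.range z) ∩ Metric.closedBall 0 ρ') :=
    Finset.sum_nonneg fun j _ => hF0 _
  linarith

/-- **Local slack control.** If `dist (z j) (z i) ≤ L` then `F(star_j)` and every `U(r_jj')`,
`j' ≠ j`, are bounded by the `L`-local slack `σ_i^L = Σ_{j : dist(z j, z i) ≤ L} τ_j`. [folklore] -/
theorem star_le_localSlack_and_pair_le (hU0 : ∀ r : ℝ, 0 < r → 0 ≤ U r)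
    (hF0 : ∀ T : Set E3, 0 ≤ F T) (hz : Function.Injective z) {L : ℝ} {i j : Fin M}
    (hji : dist (z j) (z i) ≤ L) :
    F (((fun w => w - z j) '' Set.range z) ∩ Metric.closedBall 0 ρ') ≤
        ∑ j' ∈ Finset.univ.filter (fun j' => dist (z j') (z i) ≤ L),
          (F (((fun w => w - z j') '' Set.range z) ∩ Metric.closedBall 0 ρ') +
            siteEnergy U z j') ∧
      ∀ j' : Fin M, j' ≠ j → U (dist (z j) (z j')) ≤
        ∑ j' ∈ Finset.univ.filter (fun j' => dist (z j') (z i) ≤ L),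
          (F (((fun w => w - z j') '' Set.range z) ∩ Metric.closedBall 0 ρ') +
            siteEnergy U z j') := by
  classical
  have hjmem : j ∈ Finset.univ.filter (fun j' => dist (z j') (z i) ≤ L) :=
    Finset.mem_filter.2 ⟨Finset.mem_univ _, hji⟩
  have hτj : F (((fun w => w - z j) '' Set.range z) ∩ Metric.closedBall 0 ρ') +
      siteEnergy U z j ≤
      ∑ j' ∈ Finset.univ.filter (fun j' => dist (z j') (z i) ≤ L),
        (F (((fun w => w - z j') '' Set.range z) ∩ Metric.closedBall 0 ρ') +
          siteEnergy U z j') :=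
    Finset.single_le_sum (f := fun j' => F (((fun w => w - z j') '' Set.range z) ∩
      Metric.closedBall 0 ρ') + siteEnergy U z j')
      (fun j' _ => siteWeight_nonneg hU0 hF0 hz j') hjmem
  have hsite : 0 ≤ siteEnergy U z j :=
    Finset.sum_nonneg fun k hk => hU0 _ (dist_pos.2 (hz.ne (Finset.ne_of_mem_erase hk).symm))
  refine ⟨by linarith [hF0 (((fun w => w - z j) '' Set.range z) ∩ Metric.closedBall 0 ρ')],
    fun j' hj' => ?_⟩
  have hU : U (dist (z j) (z j')) ≤ siteEnergy U z j :=
    Finset.single_le_sum (f := fun k => U (dist (z j) (z k)))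
      (fun k hk => hU0 _ (dist_pos.2 (hz.ne (Finset.ne_of_mem_erase hk).symm)))
      (Finset.mem_erase.2 ⟨hj', Finset.mem_univ _⟩)
  linarith [hF0 (((fun w => w - z j) '' Set.range z) ∩ Metric.closedBall 0 ρ')]

/-- **A bad particle of small local slack.** On a `1/3`-separated configuration, if the number of
bad particles exceeds `(6L+1)³ · 2·slack / η`, some bad particle has `L`-local slack `≤ η`
(double counting `sum_sum_filter_le_mul_sum` and Markov `card_filter_mul_le_sum`). [folklore] -/
theorem exists_bad_localSlack_le (P : PeriodicConfiguration 3) (R ε : ℝ)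
    (hU0 : ∀ r : ℝ, 0 < r → 0 ≤ U r) (hF0 : ∀ T : Set E3, 0 ≤ F T)
    (hsep : ∀ i j : Fin M, i ≠ j → (1 / 3 : ℝ) ≤ dist (z i) (z j)) {L η : ℝ} (hL : 0 ≤ L)
    (hη : 0 < η)
    (hcount : (6 * L + 1) ^ 3 * (2 * (∑ j, F (((fun w => w - z j) '' Set.range z) ∩
        Metric.closedBall 0 ρ') + interactionEnergy U z)) / η <
      Nat.card {i : Fin M // ¬ Good P R ε z i}) :
    ∃ i : Fin M, ¬ Good P R ε z i ∧
      ∑ j' ∈ Finset.univ.filter (fun j' => dist (z j') (z i) ≤ L),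
        (F (((fun w => w - z j') '' Set.range z) ∩ Metric.closedBall 0 ρ') +
          siteEnergy U z j') ≤ η := by
  classical
  have hz : Function.Injective z := injective_of_separated (by norm_num) hsep
  set τ : Fin M → ℝ := fun j' => F (((fun w => w - z j') '' Set.range z) ∩
    Metric.closedBall 0 ρ') + siteEnergy U z j' with hτ
  set σ : Fin M → ℝ := fun i => ∑ j' ∈ Finset.univ.filter (fun j' => dist (z j') (z i) ≤ L), τ j'
    with hσ
  have hτ0 : ∀ j', 0 ≤ τ j' := fun j' => siteWeight_nonneg hU0 hF0 hz j'
  have hσ0 : ∀ i, 0 ≤ σ i := fun i => Finset.sum_nonneg fun j' _ => hτ0 j'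
  -- Markov + double counting
  have h1 : η * ((Finset.univ.filter fun i => η < σ i).card : ℝ) ≤ ∑ i, σ i :=
    card_filter_mul_le_sum hσ0 η
  have h2 : ∑ i, σ i ≤ (6 * L + 1) ^ 3 * ∑ j', τ j' := sum_sum_filter_le_mul_sum hsep hτ0 hL
  have h3 : ∑ j', τ j' ≤ 2 * (∑ j, F (((fun w => w - z j) '' Set.range z) ∩
      Metric.closedBall 0 ρ') + interactionEnergy U z) := sum_siteWeight_le hF0
  have hC : 0 ≤ (6 * L + 1) ^ 3 := by positivity
  have h4 : ((Finset.univ.filter fun i => η < σ i).card : ℝ) ≤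
      (6 * L + 1) ^ 3 * (2 * (∑ j, F (((fun w => w - z j) '' Set.range z) ∩
        Metric.closedBall 0 ρ') + interactionEnergy U z)) / η := by
    rw [le_div_iff₀ hη, mul_comm]
    exact h1.trans (h2.trans (mul_le_mul_of_nonneg_left h3 hC))
  have h5 : ((Finset.univ.filter fun i => η < σ i).card : ℝ) <
      ((Finset.univ.filter fun i => ¬ Good P R ε z i).card : ℝ) := by
    have e : Nat.card {i : Fin M // ¬ Good P R ε z i} =
        (Finset.univ.filter fun i => ¬ Good P R ε z i).card := by
      rw [Nat.card_eq_fintype_card, Fintype.card_subtype]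
    rw [e] at hcount
    exact h4.trans_lt hcount
  have h6 : ¬ (Finset.univ.filter fun i => ¬ Good P R ε z i) ⊆
      (Finset.univ.filter fun i => η < σ i) := fun hsub =>
    (Nat.cast_lt.1 h5).not_ge (Finset.card_le_card hsub)
  obtain ⟨i, hi, hi'⟩ := Finset.not_subset.1 h6
  refine ⟨i, (Finset.mem_filter.1 hi).2, ?_⟩
  have : ¬ η < σ i := fun h => hi' (Finset.mem_filter.2 ⟨Finset.mem_univ _, h⟩)
  exact not_lt.1 this

end OneConfig


/-! ## The registered stub -/

/-- **Stub 3 of line `c-layer-witness-strictness` — ROOTING.** From the thinning statement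
(stub 2), certificate data for a periodic `P` (split `V_LJ = g + U + f` on `(0,∞)`, `U ≥ 0`, `f` of
positive type, star functional `F ≥ 0` with `Σ_i F(star_i) ≤ Σ_{i<j} g + cN`, exact constant
`c + f(0)/2 = −e(P)`, trial-state bound) and a FAILURE of `RigidFor P`, a rooted small-slack bad
sequence: `1/3`-separated sets `S_k ∋ 0`, none root-matched at `(R, ε)`, with vanishing local
`(F, U)`-slack.  See the module docstring for the proof. [folklore] -/
theorem stub_rooting :
    (∃ K : ℝ, 0 < K ∧ ∀ (N : ℕ) (x : Fin N → E3), Function.Injective x →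
      ∃ (M : ℕ) (y : Fin M → E3), Function.Injective y ∧ Set.range y ⊆ Set.range x ∧
        (∀ i j : Fin M, i ≠ j → (1 / 3 : ℝ) ≤ dist (y i) (y j)) ∧ M ≤ N ∧
        K * ((N : ℝ) - M) ≤ interactionEnergy lennardJones x - groundStateEnergy lennardJones 3 N ∧
        interactionEnergy lennardJones y ≤ interactionEnergy lennardJones x) →
    ∀ (P : PeriodicConfiguration 3) (c ρ' : ℝ) (g U f : ℝ → ℝ) (F : Set E3 → ℝ),
      (∀ r : ℝ, 0 < r → lennardJones r = g r + U r + f r) →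
      (∀ r : ℝ, 0 < r → 0 ≤ U r) →
      (∀ (n : ℕ) (y : Fin n → E3) (w : Fin n → ℝ),
        0 ≤ ∑ i, ∑ j, w i * w j * f (dist (y i) (y j))) →
      (∀ T : Set E3, 0 ≤ F T) →
      (∀ (N : ℕ) (x : Fin N → E3), Function.Injective x →
        ∑ i, F (((fun z => z - x i) '' Set.range x) ∩ Metric.closedBall 0 ρ') ≤
          interactionEnergy g x + c * N) →
      c + f 0 / 2 = -(P.energyPerParticle lennardJones) →
      (∀ η : ℝ, 0 < η → ∃ N₀ : ℕ, ∀ N : ℕ, N₀ ≤ N →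
        groundStateEnergy lennardJones 3 N ≤ (N : ℝ) * (P.energyPerParticle lennardJones + η)) →
      ¬ RigidFor P →
      ∃ (R ε : ℝ), 0 < R ∧ 0 < ε ∧ ∃ S : ℕ → Set E3,
        (∀ k, ∀ p ∈ S k, ∀ q ∈ S k, p ≠ q → (1 / 3 : ℝ) ≤ dist p q) ∧
        (∀ k, (0 : E3) ∈ S k) ∧
        (∀ k, ¬ ∃ A : E3 →ₗᵢ[ℝ] E3,
          (∀ p ∈ P.points, ‖p‖ ≤ R → ∃ q ∈ S k, dist q (A p) ≤ ε) ∧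
          (∀ q ∈ S k, ‖q‖ ≤ R → ∃ p ∈ P.points, dist q (A p) ≤ ε)) ∧
        (∀ L η : ℝ, 0 < η → ∀ᶠ k in Filter.atTop, ∀ s ∈ S k, ‖s‖ ≤ L →
          F (((fun z => z - s) '' S k) ∩ Metric.closedBall 0 ρ') ≤ η ∧
          ∀ s' ∈ S k, s' ≠ s → ‖s'‖ ≤ L → U (dist s s') ≤ η) := by
  intro hthin P c ρ' g U f F hsplit hU0 hf hF0 hstar hid htrial hrig
  classical
  -- (0) unpack the failing witness: `(R, ε)`, the bad sequence `x`, and `θ > 0`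
  have hrig' : ∃ R ε : ℝ, 0 < R ∧ 0 < ε ∧ ∃ x : (N : ℕ) → Fin N → E3,
      (∀ N, Function.Injective (x N)) ∧ ExcessVanishes x ∧ ¬ BadFractionVanishes P R ε x := by
    by_contra hcon
    apply hrig
    intro R ε hR hε x hxinj hexc
    by_contra hbad
    exact hcon ⟨R, ε, hR, hε, x, hxinj, hexc, hbad⟩
  obtain ⟨R, ε, hR, hε, x, hxinj, hexc, hnot⟩ := hrig'
  obtain ⟨θ, hθ, hfreq⟩ := exists_frequently_le_of_not_tendsto
    (u := fun N => (badCount P R ε (x N) : ℝ) / N) (fun N => by positivity) hnot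
  -- (1) thinning
  obtain ⟨K, hK, hth⟩ := hthin
  choose M y hyinj hysub hysep hMN hKM hEy using fun N => hth N (x N) (hxinj N)
  -- abbreviations
  set e : ℝ := P.energyPerParticle lennardJones with he
  set slack : ℕ → ℝ := fun N =>
    ∑ i, F (((fun w => w - y N i) '' Set.range (y N)) ∩ Metric.closedBall 0 ρ') +
      interactionEnergy U (y N) with hslack
  set excess : ℕ → ℝ := fun N =>
    interactionEnergy lennardJones (x N) - groundStateEnergy lennardJones 3 N with hexcess
  have hexcess0 : ∀ N, 0 ≤ excess N := fun N => by
    simp only [hexcess, sub_nonneg]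
    exact groundStateEnergy_lennardJones_le (hxinj N)
  -- (2) the slack of the thinned configuration is `o(N)`
  have hsl : ∀ N, slack N ≤ excess N * (1 + |e| / K) +
      (groundStateEnergy lennardJones 3 N - N * e) := by
    intro N
    have ha : slack N ≤ interactionEnergy lennardJones (y N) + (c + f 0 / 2) * (M N) :=
      sum_star_add_interactionEnergy_le hsplit hf hstar (hyinj N)
    have hb : ((N : ℝ) - M N) ≤ excess N / K := by
      rw [le_div_iff₀ hK, mul_comm]; exact hKM N
    have hc : e * ((N : ℝ) - M N) ≤ |e| * (excess N / K) := by
      have h1 : e * ((N : ℝ) - M N) ≤ |e| * ((N : ℝ) - M N) := by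
        have hNM : (0 : ℝ) ≤ (N : ℝ) - M N := by
          have := hMN N
          have : ((M N : ℕ) : ℝ) ≤ N := by exact_mod_cast this
          linarith
        exact mul_le_mul_of_nonneg_right (le_abs_self e) hNM
      exact h1.trans (mul_le_mul_of_nonneg_left hb (abs_nonneg e))
    have hd := hEy N
    have hexp : excess N * (1 + |e| / K) = excess N + |e| * (excess N / K) := by ring
    rw [hexp, hid] at *
    linarith
  have h2c : ∀ κ : ℝ, 0 < κ → ∀ᶠ N in atTop, slack N ≤ κ * N := by
    intro κ hκ
    have hA : 0 < 1 + |e| / K := by positivity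
    set κ' : ℝ := κ / (2 * (1 + |e| / K)) with hκ'
    have hκ'pos : 0 < κ' := by positivity
    obtain ⟨N₀, hN₀⟩ := htrial (κ / 2) (by positivity)
    have hev : ∀ᶠ N : ℕ in atTop, excess N / N < κ' := (tendsto_order.1 hexc).2 κ' hκ'pos
    filter_upwards [hev, eventually_ge_atTop N₀, eventually_ge_atTop 1] with N hN hN₀N hN1
    have hNpos : (0 : ℝ) < N := by exact_mod_cast hN1
    have h1 : excess N < κ' * N := by rwa [div_lt_iff₀ hNpos] at hN
    have h2 : groundStateEnergy lennardJones 3 N - N * e ≤ N * (κ / 2) := by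
      have := hN₀ N hN₀N; linarith
    have h3 : excess N * (1 + |e| / K) ≤ κ' * N * (1 + |e| / K) :=
      mul_le_mul_of_nonneg_right h1.le hA.le
    have h4 : κ' * N * (1 + |e| / K) = κ / 2 * N := by
      rw [hκ']; field_simp
    linarith [hsl N]
  -- (3) frequently many bad particles survive the thinning
  have h3c : ∃ᶠ N in atTop, θ / 2 * N < Nat.card {i : Fin (M N) // ¬ Good P R ε (y N) i} ∧
      (1 : ℝ) ≤ N := by
    have hCR : 0 ≤ (6 * R + 1) ^ 3 := by positivity
    have hev1 : ∀ᶠ N : ℕ in atTop, excess N / K * (1 + (6 * R + 1) ^ 3) < θ / 2 * N := by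
      have hpos : 0 < θ / 2 / ((1 + (6 * R + 1) ^ 3) / K) := by positivity
      have hev := (tendsto_order.1 hexc).2 _ hpos
      filter_upwards [hev, eventually_ge_atTop 1] with N hN hN1
      have hNpos : (0 : ℝ) < N := by exact_mod_cast hN1
      have hX : 0 < (1 + (6 * R + 1) ^ 3) / K := by positivity
      rw [div_lt_iff₀ hNpos] at hN
      have h' := mul_lt_mul_of_pos_right hN hX
      have hrw : θ / 2 / ((1 + (6 * R + 1) ^ 3) / K) * N * ((1 + (6 * R + 1) ^ 3) / K) =
          θ / 2 * N := by
        field_simp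
      calc excess N / K * (1 + (6 * R + 1) ^ 3) = excess N * ((1 + (6 * R + 1) ^ 3) / K) := by
            ring
        _ < θ / 2 * N := by rw [← hrw]; exact h'
    refine (hfreq.and_eventually (hev1.and (eventually_ge_atTop 1))).mono ?_
    rintro N ⟨hθN, hev, hN1⟩
    have hN1' : (1 : ℝ) ≤ N := by exact_mod_cast hN1
    have hNpos : (0 : ℝ) < N := by linarith
    refine ⟨?_, hN1'⟩
    have hbx : θ * N ≤ (badCount P R ε (x N) : ℝ) := by rwa [le_div_iff₀ hNpos] at hθN
    have htr := badCount_le_badCount_thinned P R ε (hxinj N) (hysep N) (hysub N) hR.le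
    have hb : ((N : ℝ) - M N) * (1 + (6 * R + 1) ^ 3) ≤ excess N / K * (1 + (6 * R + 1) ^ 3) := by
      refine mul_le_mul_of_nonneg_right ?_ (by positivity)
      rw [le_div_iff₀ hK, mul_comm]; exact hKM N
    have : (badCount P R ε (x N) : ℝ) = Nat.card {i : Fin N // ¬ Good P R ε (x N) i} := rfl
    rw [this] at hbx
    linarith
  -- (4) frequently a bad particle of small local slack
  have h4c : ∀ L η : ℝ, 0 ≤ L → 0 < η → ∃ᶠ N in atTop, ∃ i : Fin (M N),
      ¬ Good P R ε (y N) i ∧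
      ∑ j' ∈ Finset.univ.filter (fun j' => dist (y N j') (y N i) ≤ L),
        (F (((fun w => w - y N j') '' Set.range (y N)) ∩ Metric.closedBall 0 ρ') +
          siteEnergy U (y N) j') ≤ η := by
    intro L η hL hη
    have hC : 0 < (6 * L + 1) ^ 3 := by positivity
    have hκ : 0 < θ * η / (16 * (6 * L + 1) ^ 3) := by positivity
    refine (h3c.and_eventually (h2c _ hκ)).mono ?_
    rintro N ⟨⟨hbad, hN1⟩, hsN⟩
    refine exists_bad_localSlack_le P R ε hU0 hF0 (hysep N) hL hη (lt_of_le_of_lt ?_ hbad)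
    rw [div_le_iff₀ hη]
    have h1 : (6 * L + 1) ^ 3 * (2 * slack N) ≤
        (6 * L + 1) ^ 3 * (2 * (θ * η / (16 * (6 * L + 1) ^ 3) * N)) :=
      mul_le_mul_of_nonneg_left (by linarith) hC.le
    have h2 : (6 * L + 1) ^ 3 * (2 * (θ * η / (16 * (6 * L + 1) ^ 3) * N)) = θ * η * N / 8 := by
      field_simp; ring
    have h3 : θ * η * N / 8 ≤ θ / 2 * N * η := by
      have hprod : 0 < θ * η * N := by positivity
      have hrw : θ / 2 * N * η = 4 * (θ * η * N / 8) := by ring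
      rw [hrw]; linarith
    simpa only [hslack] using h1.trans (h2.le.trans h3)
  -- (5) the diagonal choice
  have h5 : ∀ k : ℕ, ∃ N : ℕ, ∃ i : Fin (M N), ¬ Good P R ε (y N) i ∧
      ∑ j' ∈ Finset.univ.filter (fun j' => dist (y N j') (y N i) ≤ (k : ℝ)),
        (F (((fun w => w - y N j') '' Set.range (y N)) ∩ Metric.closedBall 0 ρ') +
          siteEnergy U (y N) j') ≤ 1 / ((k : ℝ) + 1) := fun k =>
    (h4c k (1 / ((k : ℝ) + 1)) (Nat.cast_nonneg k) (by positivity)).exists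
  choose Nk ik hbadk hσk using h5
  refine ⟨R, ε, hR, hε, fun k => (fun w => w - y (Nk k) (ik k)) '' Set.range (y (Nk k)),
    fun k => separated_image_sub_range (hysep (Nk k)) _,
    fun k => ⟨y (Nk k) (ik k), ⟨ik k, rfl⟩, sub_self _⟩,
    fun k hmatch => hbadk k ((good_iff_rootMatched_image P R ε (y (Nk k)) (ik k)).2 hmatch),
    fun L η hη => ?_⟩
  -- local slack control along the diagonal
  refine Filter.eventually_atTop.2 ⟨max ⌈L⌉₊ ⌈1 / η⌉₊, fun k hk => ?_⟩
  have hkL : L ≤ (k : ℝ) := (Nat.le_ceil L).trans (by exact_mod_cast (le_max_left _ _).trans hk)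
  have hkη : 1 / ((k : ℝ) + 1) ≤ η := by
    have h1 : 1 / η ≤ (k : ℝ) := (Nat.le_ceil (1 / η)).trans
      (by exact_mod_cast (le_max_right _ _).trans hk)
    rw [div_le_iff₀ (by positivity)]
    rw [div_le_iff₀ hη] at h1
    nlinarith
  set z := y (Nk k) with hz
  set i := ik k with hi
  have hzinj : Function.Injective z := hyinj (Nk k)
  intro s hs hsL
  obtain ⟨_, ⟨j, rfl⟩, rfl⟩ := hs
  have hji : dist (z j) (z i) ≤ (k : ℝ) := by
    rw [dist_eq_norm]; exact hsL.trans hkL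
  obtain ⟨hF, hU⟩ := star_le_localSlack_and_pair_le (ρ' := ρ') hU0 hF0 hzinj hji
  have hσ := hσk k
  refine ⟨?_, ?_⟩
  · rw [image_sub_image_sub]
    exact hF.trans (hσ.trans hkη)
  · intro s' hs' hne _
    obtain ⟨_, ⟨j', rfl⟩, rfl⟩ := hs'
    have hjj' : j' ≠ j := fun h => hne (by rw [h])
    rw [dist_sub_sub_eq]
    exact (hU j' hjj').trans (hσ.trans hkη)

end Summit.AtomisticToContinuum.Crystallization.Theorems.CLayerWitnessRooting

end
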